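import Mathlib
import Literature.Computability.AlgebraicComplexity.ArithCircuitProofs
import HarnessLib

/-!
# Item `BarrierLever.NaturalProofsSeparateVNP` (stmt-ValiantsHypothesis-18972), SIGN SLICE —
# part 7: the CKRST equation over an ARBITRARY finite set of coefficient variables

Generalises part 4 (`…SignSliceEquation.lean`, coefficient variables `degLEMonomials n`, values
`a^m`) to an arbitrary finite index type `ι` of coefficient variables with an arbitrary vector of
"true values" `v : ι → ℕ` (in the application, `ι = monomialsDegLE n (n^c)` and `v_m = a^m`), as
needed for the AS-PRINTED form of CKRST 2020 Thm. 1.1 (`CKRST20NaturalProofsExist.lean`):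

  `equation v K R = Λ · ∏_{r=2}^{K} Q_{R,r}(∑_i z_i · (v_i mod r))`,
  `Λ = 1 - ∏_i (1 - z_i²)`, `Q_{R,r}(u) = ∏_{|j| ≤ R, r ∤ j} (u - j)`.

* `EqGen.eval_equation_intCast_eq_zero_of_not_dvd` / `eval_equation_zero` /
  `eval_equation_intCast_ne_zero` — vanishing at `{0,1,-1}`-vectors `e` with `r ∤ ∑_i e_i v_i` for
  some `r ∈ [2, K]` (and at `0`), non-vanishing at nonzero ones with `r ∣ ∑_i e_i v_i` for all such
  `r` (given `#ι · K ≤ R`);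
* `EqGen.totalDegree_equation_le`, `EqGen.complexity_equation_le` — degree `≤ 2#ι + K(2R+1)`, size
  `≤ 4#ι + 3 + K((2R+1)(2#ι+2)+1)`.

References: [ChatterjeeKumarRamyaSaptharishiTengse2020] §4 (proof of Thm. 1.1);
[Burgisser2000] Def. 2.1 (`complexity`).
-/

-- layout Summits/ValiantsHypothesis/ValiantsHypothesis forces the duplicated namespace component
set_option linter.dupNamespace false

noncomputable section

namespace Summit.ValiantsHypothesis.ValiantsHypothesis.Theorems.BarrierLever.NaturalProofsSeparateVNP

open Literature.Computability.AlgebraicComplexity MvPolynomial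

namespace EqGen

variable {ι : Type*}

section WithFintype

variable [Fintype ι]

/-! ### `Λ = 1 - ∏_m (1 - z_m²)`: vanishes exactly at the zero sign vector -/

/-- `Λ = 1 - ∏_m (1 - z_m²)` (written with `C (-1)` for the gate count).
[cite: ChatterjeeKumarRamyaSaptharishiTengse2020, §4] -/
def lam (ι : Type*) [Fintype ι] : MvPolynomial ι ℂ :=
  C 1 + C (-1) * ∏ m : ι, (C 1 + C (-1) * (X m * X m))

/-- At a `{0,1,-1}`-vector `e`: `Λ(e) = 0` if `e = 0` and `Λ(e) = 1` otherwise.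
[cite: ChatterjeeKumarRamyaSaptharishiTengse2020, §4] -/
theorem eval_lam_intCast (e : ι → ℤ) (he : ∀ m, e m = 0 ∨ e m = 1 ∨ e m = -1) :
    eval (fun m => ((e m : ℤ) : ℂ)) (lam ι) = if e = 0 then 0 else 1 := by
  classical
  have hfac : ∀ m, eval (fun m => ((e m : ℤ) : ℂ)) (C 1 + C (-1) * (X m * X m)) =
      if e m = 0 then 1 else 0 := by
    intro m
    simp only [map_add, map_mul, eval_C, eval_X]
    rcases he m with h | h | h <;> simp [h]
  simp only [lam, map_add, map_mul, eval_C, map_prod, hfac]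
  split_ifs with h0
  · subst h0
    simp
  · obtain ⟨m, hm⟩ : ∃ m, e m ≠ 0 := by
      by_contra hcon
      push Not at hcon
      exact h0 (funext hcon)
    rw [Finset.prod_eq_zero (Finset.mem_univ m) (by simp [hm])]
    simp

/-! ### The linear form `⟨z, w⟩` and its integer value -/

/-- `⟨z, w⟩ = ∑_m w_m z_m` for a weight vector `w ∈ ℕ^N`. [cite: ChatterjeeKumarRamyaSaptharishiTengse2020, §4] -/
def linForm (w : ι → ℕ) : MvPolynomial ι ℂ :=
  ∑ m : ι, C (w m : ℂ) * X m

/-- The integer `∑_m e_m w_m`. [cite: ChatterjeeKumarRamyaSaptharishiTengse2020, §4] -/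
def proxyVal (w : ι → ℕ) (e : ι → ℤ) : ℤ :=
  ∑ m : ι, e m * (w m : ℤ)

/-- `⟨e, w⟩ = proxyVal w e` in `ℂ`. [cite: ChatterjeeKumarRamyaSaptharishiTengse2020, §4] -/
theorem eval_linForm_intCast (w : ι → ℕ) (e : ι → ℤ) :
    eval (fun m => ((e m : ℤ) : ℂ)) (linForm w) = (proxyVal w e : ℂ) := by
  simp only [linForm, proxyVal, map_sum, map_mul, eval_C, eval_X]
  push_cast
  exact Finset.sum_congr rfl fun m _ => mul_comm _ _

/-- `|∑_m e_m w_m| ≤ N · W` for `|e_m| ≤ 1`, `w_m ≤ W`. [cite: ChatterjeeKumarRamyaSaptharishiTengse2020, §4] -/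
theorem natAbs_proxyVal_le {w : ι → ℕ} {W : ℕ} (hw : ∀ m, w m ≤ W)
    {e : ι → ℤ} (he : ∀ m, (e m).natAbs ≤ 1) :
    (proxyVal w e).natAbs ≤ Fintype.card ι * W := by
  unfold proxyVal
  calc (∑ m, e m * (w m : ℤ)).natAbs ≤ ∑ m, (e m * (w m : ℤ)).natAbs := Int.natAbs_sum_le _ _
    _ ≤ ∑ _m : ι, W := Finset.sum_le_sum fun m _ => by
        rw [Int.natAbs_mul, Int.natAbs_natCast]
        calc (e m).natAbs * w m ≤ 1 * W := Nat.mul_le_mul (he m) (hw m)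
          _ = W := one_mul _
    _ = _ := by rw [Finset.sum_const, smul_eq_mul, Finset.card_univ]

/-! ### `Q_{R,r}(⟨z, w⟩) = ∏_{|j| ≤ R, r ∤ j} (⟨z, w⟩ - j)` -/

/-- The admissible roots: integers `j ∈ [-R, R]` not divisible by `r`. [cite: ChatterjeeKumarRamyaSaptharishiTengse2020, §4] -/
def roots (R r : ℕ) : Finset ℤ :=
  (Finset.Icc (-(R : ℤ)) R).filter (fun j => ¬ (r : ℤ) ∣ j)

/-- There are at most `2R + 1` admissible roots. [folklore] -/
theorem card_roots_le (R r : ℕ) : (roots R r).card ≤ 2 * R + 1 := by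
  unfold roots
  refine (Finset.card_filter_le _ _).trans ?_
  rw [Int.card_Icc]
  omega

/-- `Q_{R,r}(⟨z, w⟩)`. [cite: ChatterjeeKumarRamyaSaptharishiTengse2020, §4] -/
def qFactor (R r : ℕ) (w : ι → ℕ) : MvPolynomial ι ℂ :=
  ∏ j ∈ roots R r, (linForm w + C (-(j : ℂ)))

/-- `Q_{R,r}` at a vector `e`: zero iff the integer `∑_m e_m w_m` (of size `≤ R`) is NOT divisible
by `r`. [cite: ChatterjeeKumarRamyaSaptharishiTengse2020, §4] -/
theorem eval_qFactor_intCast_eq_zero_iff {R r : ℕ} (w : ι → ℕ)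
    (e : ι → ℤ) (hbound : (proxyVal w e).natAbs ≤ R) :
    eval (fun m => ((e m : ℤ) : ℂ)) (qFactor R r w) = 0 ↔ ¬ (r : ℤ) ∣ proxyVal w e := by
  simp only [qFactor, map_prod, map_add, eval_C, eval_linForm_intCast, Finset.prod_eq_zero_iff]
  constructor
  · rintro ⟨j, hj, h⟩
    have : proxyVal w e = j := by
      have h' : ((proxyVal w e : ℤ) : ℂ) = (j : ℂ) := by
        rw [← sub_eq_zero, sub_eq_add_neg]; exact h
      exact_mod_cast h'
    rw [this]
    exact (Finset.mem_filter.mp hj).2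
  · intro hnd
    refine ⟨proxyVal w e, Finset.mem_filter.mpr ⟨Finset.mem_Icc.mpr ⟨?_, ?_⟩, hnd⟩, by ring⟩
    · have h1 := neg_abs_le (proxyVal w e)
      rw [← Int.natCast_natAbs] at h1; omega
    · have h2 := le_abs_self (proxyVal w e)
      rw [← Int.natCast_natAbs] at h2; omega

end WithFintype

/-! ### Residues of the true values and the congruence -/

section Residues

/-- The weights `v_i mod r`. [cite: ChatterjeeKumarRamyaSaptharishiTengse2020, §4] -/
def modW (v : ι → ℕ) (r : ℕ) : ι → ℕ := fun m => v m % r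

/-- `v_i mod r ≤ K` when `0 < r ≤ K`. [folklore] -/
theorem modW_le {v : ι → ℕ} {r K : ℕ} (hr : 0 < r) (hrK : r ≤ K) (m : ι) :
    modW v r m ≤ K :=
  ((Nat.mod_lt _ hr).le).trans hrK

end Residues

section WithFintype2

variable [Fintype ι]

/-- The "true" integer value `∑_i e_i v_i` of which the proxy sums are residue images.
[cite: ChatterjeeKumarRamyaSaptharishiTengse2020, §4] -/
def trueVal (v : ι → ℕ) (e : ι → ℤ) : ℤ := ∑ m : ι, e m * (v m : ℤ)

/-- The proxy evaluation is congruent to the true one: `r ∣ ∑_i e_i (v_i mod r) - ∑_i e_i v_i`.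
[cite: ChatterjeeKumarRamyaSaptharishiTengse2020, Claim 13] -/
theorem dvd_proxyVal_modW_sub_trueVal (v : ι → ℕ) (r : ℕ) (e : ι → ℤ) :
    (r : ℤ) ∣ proxyVal (modW v r) e - trueVal v e := by
  unfold proxyVal trueVal modW
  rw [← Finset.sum_sub_distrib]
  refine Finset.dvd_sum fun m _ => ?_
  rw [← mul_sub]
  refine Dvd.dvd.mul_left ?_ _
  rw [Int.natCast_mod, Int.emod_def]
  exact ⟨-((v m : ℤ) / r), by ring⟩

/-! ### The equation and its evaluations -/

/-- **The CKRST equation** `Λ · ∏_{r=2}^{K} Q_{R,r}(∑_i z_i (v_i mod r))`.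
[cite: ChatterjeeKumarRamyaSaptharishiTengse2020, §4] -/
def equation (v : ι → ℕ) (K R : ℕ) : MvPolynomial ι ℂ :=
  lam ι * ∏ r ∈ Finset.Icc 2 K, qFactor R r (modW v r)

/-- The equation vanishes at the zero vector. [cite: ChatterjeeKumarRamyaSaptharishiTengse2020, §4] -/
theorem eval_equation_zero (v : ι → ℕ) (K R : ℕ) :
    eval (fun m => (((0 : ι → ℤ) m : ℤ) : ℂ)) (equation v K R) = 0 := by
  rw [equation, map_mul, eval_lam_intCast 0 (fun _ => Or.inl rfl), if_pos rfl, zero_mul]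

/-- **Vanishing.** If `r ∤ ∑_i e_i v_i` for some `r ∈ [2, K]`, and `N · K ≤ R`, the equation vanishes
at the `{0,1,-1}`-vector `e`. [cite: ChatterjeeKumarRamyaSaptharishiTengse2020, §4] -/
theorem eval_equation_intCast_eq_zero_of_not_dvd (v : ι → ℕ) {K R : ℕ}
    (hR : Fintype.card ι * K ≤ R) {e : ι → ℤ}
    (he : ∀ m, (e m).natAbs ≤ 1) {r : ℕ} (hr2 : 2 ≤ r) (hrK : r ≤ K)
    (hnd : ¬ (r : ℤ) ∣ trueVal v e) :
    eval (fun m => ((e m : ℤ) : ℂ)) (equation v K R) = 0 := by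
  rw [equation, map_mul, map_prod]
  refine mul_eq_zero_of_right _ (Finset.prod_eq_zero (Finset.mem_Icc.mpr ⟨hr2, hrK⟩) ?_)
  have hbound : (proxyVal (modW v r) e).natAbs ≤ R :=
    (natAbs_proxyVal_le (modW_le (by omega) hrK) he).trans hR
  rw [eval_qFactor_intCast_eq_zero_iff _ _ hbound]
  intro hdvd
  exact hnd ((dvd_sub_right hdvd).mp (dvd_proxyVal_modW_sub_trueVal v r e))

/-- **Non-vanishing.** If `e ≠ 0` is a `{0,1,-1}`-vector with `r ∣ ∑_i e_i v_i` for every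
`r ∈ [2, K]` (e.g. `∑_i e_i v_i = 0`), and `N · K ≤ R`, the equation does not vanish at `e`.
[cite: ChatterjeeKumarRamyaSaptharishiTengse2020, §4] -/
theorem eval_equation_intCast_ne_zero (v : ι → ℕ) {K R : ℕ}
    (hR : Fintype.card ι * K ≤ R) {e : ι → ℤ}
    (he : ∀ m, e m = 0 ∨ e m = 1 ∨ e m = -1) (he0 : e ≠ 0)
    (hdvd : ∀ r : ℕ, 2 ≤ r → r ≤ K → (r : ℤ) ∣ trueVal v e) :
    eval (fun m => ((e m : ℤ) : ℂ)) (equation v K R) ≠ 0 := by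
  have he' : ∀ m, (e m).natAbs ≤ 1 := fun m => by
    rcases he m with h | h | h <;> simp [h]
  rw [equation, map_mul, map_prod, eval_lam_intCast e he, if_neg he0]
  refine mul_ne_zero one_ne_zero (Finset.prod_ne_zero_iff.mpr fun r hr => ?_)
  obtain ⟨hr2, hrK⟩ := Finset.mem_Icc.mp hr
  have hbound : (proxyVal (modW v r) e).natAbs ≤ R :=
    (natAbs_proxyVal_le (modW_le (by omega) hrK) he').trans hR
  intro h0
  rw [eval_qFactor_intCast_eq_zero_iff _ _ hbound] at h0
  exact h0 ((dvd_sub_left (hdvd r hr2 hrK)).mp (dvd_proxyVal_modW_sub_trueVal v r e))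

/-! ### Degree -/

/-- `deg ⟨z, w⟩ ≤ 1`. [folklore] -/
theorem totalDegree_linForm_le (w : ι → ℕ) : (linForm w).totalDegree ≤ 1 := by
  unfold linForm
  refine totalDegree_finsetSum_le fun m _ => (totalDegree_mul _ _).trans ?_
  rw [totalDegree_C, totalDegree_X, zero_add]

/-- `deg Q_{R,r}(⟨z, w⟩) ≤ 2R + 1`. [cite: ChatterjeeKumarRamyaSaptharishiTengse2020, §4] -/
theorem totalDegree_qFactor_le (R r : ℕ) (w : ι → ℕ) :
    (qFactor R r w).totalDegree ≤ 2 * R + 1 := by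
  unfold qFactor
  refine (totalDegree_finsetProd _ _).trans ?_
  have h1 : ∀ j ∈ roots R r, (linForm w + C (-(j : ℂ))).totalDegree ≤ 1 := fun j _ =>
    (totalDegree_add _ _).trans (max_le (totalDegree_linForm_le w) (by rw [totalDegree_C]; omega))
  refine (Finset.sum_le_card_nsmul _ _ 1 h1).trans ?_
  rw [smul_eq_mul, mul_one]; exact card_roots_le R r

/-- `deg Λ ≤ 2N`. [cite: ChatterjeeKumarRamyaSaptharishiTengse2020, §4] -/
theorem totalDegree_lam_le : (lam ι).totalDegree ≤ 2 * Fintype.card ι := by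
  unfold lam
  refine (totalDegree_add _ _).trans (max_le (by rw [totalDegree_C]; omega) ?_)
  refine (totalDegree_mul _ _).trans ?_
  rw [totalDegree_C, zero_add]
  refine (totalDegree_finsetProd _ _).trans ?_
  have h1 : ∀ m ∈ (Finset.univ : Finset ι),
      (C 1 + C (-1) * (X m * X m) : MvPolynomial ι ℂ).totalDegree ≤ 2 := by
    intro m _
    refine (totalDegree_add _ _).trans (max_le (by rw [totalDegree_C]; omega) ?_)
    refine (totalDegree_mul _ _).trans ?_
    rw [totalDegree_C, zero_add]
    refine (totalDegree_mul _ _).trans ?_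
    rw [totalDegree_X]
  refine (Finset.sum_le_card_nsmul _ _ 2 h1).trans ?_
  rw [Finset.card_univ, smul_eq_mul, mul_comm]

/-- **Degree of the equation**: `≤ 2N + K(2R+1)`. [cite: ChatterjeeKumarRamyaSaptharishiTengse2020, §4] -/
theorem totalDegree_equation_le (v : ι → ℕ) (K R : ℕ) :
    (equation v K R).totalDegree ≤ 2 * Fintype.card ι + K * (2 * R + 1) := by
  unfold equation
  refine (totalDegree_mul _ _).trans (Nat.add_le_add totalDegree_lam_le ?_)
  refine (totalDegree_finsetProd _ _).trans ?_
  refine (Finset.sum_le_card_nsmul _ _ (2 * R + 1) fun r _ => totalDegree_qFactor_le R r _).trans ?_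
  rw [Nat.card_Icc, smul_eq_mul]
  exact Nat.mul_le_mul_right _ (by omega)

/-! ### Size -/

/-- `L(⟨z, w⟩) ≤ 2N`. [cite: Burgisser2000, Def. 2.1] -/
theorem complexity_linForm_le (w : ι → ℕ) :
    complexity (linForm w) ≤ 2 * Fintype.card ι := by
  unfold linForm
  refine (complexity_finset_sum_le _ _).trans ?_
  have h1 : ∀ m ∈ (Finset.univ : Finset ι),
      complexity (C (w m : ℂ) * X m : MvPolynomial ι ℂ) ≤ 1 := fun m _ =>
    (complexity_mul_le_holds _ _).trans (by rw [complexity_C_holds, complexity_X_holds])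
  have := Finset.sum_le_card_nsmul _ _ 1 h1
  rw [Finset.card_univ, smul_eq_mul, mul_one] at this
  rw [Finset.card_univ]; omega

/-- `L(Q_{R,r}(⟨z, w⟩)) ≤ (2R+1)(2N+2)`. [cite: Burgisser2000, Def. 2.1] -/
theorem complexity_qFactor_le (R r : ℕ) (w : ι → ℕ) :
    complexity (qFactor R r w) ≤ (2 * R + 1) * (2 * Fintype.card ι + 2) := by
  unfold qFactor
  refine (complexity_finset_prod_le _ _).trans ?_
  have h1 : ∀ j ∈ roots R r, complexity (linForm w + C (-(j : ℂ))) ≤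
      2 * Fintype.card ι + 1 := fun j _ =>
    (complexity_add_le_holds _ _).trans (by rw [complexity_C_holds]; have := complexity_linForm_le w; omega)
  have h2 := Finset.sum_le_card_nsmul _ _ _ h1
  rw [smul_eq_mul] at h2
  have h3 := card_roots_le R r
  calc ∑ j ∈ roots R r, complexity (linForm w + C (-(j : ℂ))) + (roots R r).card
      ≤ (roots R r).card * (2 * Fintype.card ι + 1) + (roots R r).card := by omega
    _ = (roots R r).card * (2 * Fintype.card ι + 2) := by ring
    _ ≤ (2 * R + 1) * (2 * Fintype.card ι + 2) := Nat.mul_le_mul_right _ h3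

/-- `L(Λ) ≤ 4N + 2`. [cite: Burgisser2000, Def. 2.1] -/
theorem complexity_lam_le : complexity (lam ι) ≤ 4 * Fintype.card ι + 2 := by
  unfold lam
  have hfac : ∀ m ∈ (Finset.univ : Finset ι),
      complexity (C 1 + C (-1) * (X m * X m) : MvPolynomial ι ℂ) ≤ 3 := by
    intro m _
    refine (complexity_add_le_holds _ _).trans ?_
    have h1 : complexity (C (-1) * (X m * X m) : MvPolynomial ι ℂ) ≤ 2 := by
      refine (complexity_mul_le_holds _ _).trans ?_
      have h2 : complexity (X m * X m : MvPolynomial ι ℂ) ≤ 1 :=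
        (complexity_mul_le_holds _ _).trans (by rw [complexity_X_holds])
      rw [complexity_C_holds]; omega
    rw [complexity_C_holds]; omega
  have hprod : complexity (∏ m : ι, (C 1 + C (-1) * (X m * X m)) :
      MvPolynomial ι ℂ) ≤ 4 * Fintype.card ι := by
    refine (complexity_finset_prod_le _ _).trans ?_
    have := Finset.sum_le_card_nsmul _ _ 3 hfac
    rw [smul_eq_mul] at this
    rw [Finset.card_univ] at this ⊢
    omega
  refine (complexity_add_le_holds _ _).trans ?_
  have := complexity_mul_le_holds (C (-1) : MvPolynomial ι ℂ)
    (∏ m : ι, (C 1 + C (-1) * (X m * X m)))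
  rw [complexity_C_holds] at this
  rw [complexity_C_holds]
  omega

/-- **Size of the equation**: `L ≤ 4N + 3 + K((2R+1)(2N+2) + 1)`. [cite: Burgisser2000, Def. 2.1] -/
theorem complexity_equation_le (v : ι → ℕ) (K R : ℕ) :
    complexity (equation v K R) ≤ 4 * Fintype.card ι + 3 +
      K * ((2 * R + 1) * (2 * Fintype.card ι + 2) + 1) := by
  unfold equation
  refine (complexity_mul_le_holds _ _).trans ?_
  have hprod : complexity (∏ r ∈ Finset.Icc 2 K, qFactor R r (modW v r)) ≤
      K * ((2 * R + 1) * (2 * Fintype.card ι + 2) + 1) := by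
    refine (complexity_finset_prod_le _ _).trans ?_
    have h1 := Finset.sum_le_card_nsmul _ _ _ fun r (_ : r ∈ Finset.Icc 2 K) =>
      complexity_qFactor_le R r (modW v r)
    rw [smul_eq_mul, Nat.card_Icc] at h1
    rw [Nat.card_Icc]
    calc ∑ r ∈ Finset.Icc 2 K, complexity (qFactor R r (modW v r)) + (K + 1 - 2)
        ≤ (K + 1 - 2) * ((2 * R + 1) * (2 * Fintype.card ι + 2)) + (K + 1 - 2) :=
          by omega
      _ = (K + 1 - 2) * ((2 * R + 1) * (2 * Fintype.card ι + 2) + 1) := by ring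
      _ ≤ K * ((2 * R + 1) * (2 * Fintype.card ι + 2) + 1) :=
          Nat.mul_le_mul_right _ (by omega)
  have := complexity_lam_le (ι := ι)
  omega

end WithFintype2

end EqGen

end Summit.ValiantsHypothesis.ValiantsHypothesis.Theorems.BarrierLever.NaturalProofsSeparateVNP
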